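import Literature.MathematicalPhysics.QuantumFieldTheory.Balaban1983to89.T4CauchySum
import Literature.Probability.RandomMatrixProducts.AndersonModel1DEstimates

/-!
# (χ) CLASSIFIER SYNCHRONISATION for the two-run history dictionary — leaf W0 of road W-AM′
(cell `pub-balaban`, row NE7 ∕ node U5, seat `b2b-balaban-t4-ne7-p2` gen 36; kernel bookkeeping; filed by courier, see COURIER NOTE)

The issue (record `t4/T4-EST-NE7-P2.md` §36 (S23), species census: the «classifier-shell species»).  Road W-AM′
compares the `K`-step and the `(K+1)`-step renormalisation runs HISTORY BY HISTORY on a synchronised index set.  A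
history is a sequence of small ∕ large field CLASSIFICATIONS, and each run classifies with thresholds that are printed
functions of ITS OWN running couplings (B14 p.244 ll.20–31: `p₀(g_k) = A₀ (log g_k⁻²)^{p₀}`; p.245 ll.28–29; p.246
ll.4–6: `ε₀ = g₀ p₀(g₀)`, `p₀ ≥ 5r`, `A₀` large; B15 p.183: `p₁ < p₀`).  At a common lattice spacing the two runs'
couplings differ (node U2: `|x_A − x_B| ≤ C₂ θ^j` at run-age `j`, `x = g⁻²`), so their threshold tables differ, and a
field value lying BETWEEN the two thresholds is «small» in one run and «large» in the other.

What is typed here (pure real analysis; NOTHING of Bałaban's is asserted):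
* §1 EXACTNESS: classification is a partition of unity, so RE-CLASSIFYING (passing to the common refinement of the two
  runs' tables, or classifying run B with run A's table) changes the DECOMPOSITION of a partition function into history
  terms but NOT ITS VALUE (`sum_classified_eq`, `refinement_partition`, `sum_refined_eq`).  This is why either design
  below leaves `Z^A`, `Z^B` — hence node U5 — untouched.
* §2 DENSITY TRANSFER between the runs (`density_transfer`): an island-density majorant under run A's normalised
  weights transfers to run B's at the cost of a termwise ratio bound and a partition-function ratio bound — the
  algebraic form of «the shell's density under the run that calls it small-field».
* §3–§4 THE ADMISSIBILITY BAND (design (χ2), a COMMON table from some age on): coupling closeness `|x_A − x_B| ≤ d`,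
  `x ≥ m > 1`, gives `|log x_A − log x_B| ≤ d ∕ m` (the landed [folklore] `Literature.Probability.RandomMatrixProducts.abs_log_sub_log_le`, reused), hence the printed threshold of run A lies
  in the multiplicative band `[(1 − ε∕ℓ)^{p₀}, (1 + ε∕ℓ)^{p₀}] × p₀(g^B)` (`pow_band`), and a geometric U2 discrepancy
  puts it inside ANY prescribed band `η` from a `K`-INDEPENDENT age `j₀(η)` on (`eventually_le_of_geometric`).
* §5 EARLY AGES (`summable_earlyShell`): a species confined to birth ages `j < j₀` with survival density
  `≤ C r^{K−j}` (`r = Λσ < 1`, NE7b's margin) contributes a SUMMABLE total over the steps `K`.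

Designs this supports (skeleton `g36/SKELETON-NE7-P2.md`, leaf W0b):
(χ1) keep BOTH printed tables, index histories by the COMMON REFINEMENT (§1); shell cells are ordinary islands whose
     log-ratio budget is the action discrepancy and whose density needs §2 or a large-field probability bound at the
     lower threshold under the higher-threshold run — OWN-OPEN-light;
(χ2) ONE table for both runs from age `j₀(η)` on (§3–§4), shells only at ages `< j₀` (§5) — needs «threshold
     robustness of B14–B16 within an `η`-band» — OWN-OPEN-design, NOT PRINTED.
HONEST FRAMING.  continuum YM on T⁴ ⇐ BetaPertH ∧ nine spine estimates (0/9 proved); BetaPertH ⇐ (D1) ∧ (D4) ∧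
CAP+tail; G-an2-4 gates asym, D1 and NE2/3/4.  Finite T⁴, rung (B)+1; NOT infinite volume, NOT mass gap, NOT Clay.
NE7 is NOT PRINTED and NOT PROVED.

COURIER NOTE (2026-08-20, prover-b2b-balaban-t4-ne7-p3-g18-0, BINDER-OWNERS row NE7 co-owner #3): filed VERBATIM on behalf of the planner seat `b2b-balaban-t4-ne7-p2` (road W-AM′, skeleton `t4/skeletons/NE7-t4-ne7-p2.md`, its §1/§3 filing request (m1)–(m5)); content = the lineage's kernel scratch named below with ONLY the namespace moved from `T4NE7IdeasG3x` to `Summit.QuantumFields.BalabanUV.T4Continuum.WAM[.…]` and this note added; no statement changed.  Authorship and every claim in the docstrings are that seat's.  THIS FILE (m5 `WAMClassifierSync`) = `t4/b2b-balaban-t4-ne7-p2/g36/CommonThreshold.lean` 4928799370018fcf.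
-/

namespace Summit.QuantumFields.BalabanUV.T4Continuum.WAM.ClassifierSync

open Finset

/-! ## §1 Re-classification is exact -/

section Exactness

variable {Ω T T' : Type*}

/-- **Re-classification is exact**: for a linear «integral» `E` and a partition of unity `χ` (a classifier table),
the history terms `E (χ_τ · f)` sum to `E f` — whatever the table. -/
theorem sum_classified_eq (E : (Ω → ℝ) →ₗ[ℝ] ℝ) (ts : Finset T) (χ : T → Ω → ℝ)
    (hχ : ∀ ω, ∑ τ ∈ ts, χ τ ω = 1) (f : Ω → ℝ) :
    ∑ τ ∈ ts, E (fun ω => χ τ ω * f ω) = E f := by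
  rw [← map_sum]
  congr 1
  funext ω
  rw [Finset.sum_apply, ← Finset.sum_mul, hχ ω, one_mul]

/-- the product of two classifier tables (run A's and run B's) is again a partition of unity: the COMMON REFINEMENT. -/
theorem refinement_partition (ts : Finset T) (ts' : Finset T') (χ : T → Ω → ℝ) (χ' : T' → Ω → ℝ)
    (hχ : ∀ ω, ∑ τ ∈ ts, χ τ ω = 1) (hχ' : ∀ ω, ∑ τ ∈ ts', χ' τ ω = 1) (ω : Ω) :
    ∑ p ∈ ts ×ˢ ts', χ p.1 ω * χ' p.2 ω = 1 := by
  rw [Finset.sum_product]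
  dsimp only
  rw [← Finset.sum_mul_sum, hχ ω, hχ' ω, one_mul]

/-- … so BOTH runs' partition functions are unchanged by indexing histories with the common refinement. -/
theorem sum_refined_eq (E : (Ω → ℝ) →ₗ[ℝ] ℝ) (ts : Finset T) (ts' : Finset T') (χ : T → Ω → ℝ)
    (χ' : T' → Ω → ℝ) (hχ : ∀ ω, ∑ τ ∈ ts, χ τ ω = 1) (hχ' : ∀ ω, ∑ τ ∈ ts', χ' τ ω = 1) (f : Ω → ℝ) :
    ∑ p ∈ ts ×ˢ ts', E (fun ω => χ p.1 ω * χ' p.2 ω * f ω) = E f :=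
  sum_classified_eq E (ts ×ˢ ts') (fun p ω => χ p.1 ω * χ' p.2 ω)
    (refinement_partition ts ts' χ χ' hχ hχ') f

end Exactness

/-! ## §2 Density transfer between the runs -/

section Transfer

variable {T : Type*}

/-- **density transfer**: if on the histories `S` carrying an island run B's terms are at most `M ×` run A's, and
run B's partition function is at least `m ×` run A's (`m > 0`), then B's island density is at most `(M∕m) ×` A's. -/
theorem density_transfer (ts S : Finset T) (A B : T → ℝ) {M m : ℝ} (hM : 0 ≤ M) (hm : 0 < m)
    (hApos : ∀ τ ∈ ts, 0 < A τ) (hts : ts.Nonempty) (hSA : ∀ τ ∈ S, 0 ≤ A τ)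
    (hMA : ∀ τ ∈ S, B τ ≤ M * A τ) (hmS : m * ∑ τ ∈ ts, A τ ≤ ∑ τ ∈ ts, B τ) :
    ∑ τ ∈ S, B τ / ∑ σ ∈ ts, B σ ≤ M / m * ∑ τ ∈ S, A τ / ∑ σ ∈ ts, A σ := by
  have hA : 0 < ∑ τ ∈ ts, A τ := Finset.sum_pos hApos hts
  have hB : 0 < ∑ τ ∈ ts, B τ := lt_of_lt_of_le (mul_pos hm hA) hmS
  have hSA' : 0 ≤ ∑ τ ∈ S, A τ := Finset.sum_nonneg hSA
  rw [← Finset.sum_div, ← Finset.sum_div]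
  have h1 : ∑ τ ∈ S, B τ ≤ M * ∑ τ ∈ S, A τ := by
    rw [Finset.mul_sum]; exact Finset.sum_le_sum hMA
  calc (∑ τ ∈ S, B τ) / ∑ σ ∈ ts, B σ ≤ (M * ∑ τ ∈ S, A τ) / ∑ σ ∈ ts, B σ :=
        div_le_div_of_nonneg_right h1 hB.le
    _ ≤ (M * ∑ τ ∈ S, A τ) / (m * ∑ σ ∈ ts, A σ) :=
        div_le_div_of_nonneg_left (mul_nonneg hM hSA') (mul_pos hm hA) hmS
    _ = M / m * ((∑ τ ∈ S, A τ) / ∑ σ ∈ ts, A σ) := mul_div_mul_comm _ _ _ _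

end Transfer

/-! ## §3 Coupling closeness ⇒ log-coupling closeness -/

-- (courier re-cut, gate `dedup.landed`): the lineage's `abs_log_sub_log_le_div` restated the landed [folklore] lemma
-- `Literature.Probability.RandomMatrixProducts.abs_log_sub_log_le` (module `AndersonModel1DEstimates`); the copy is deleted and the
-- landed declaration is imported and used below (statement identical: `0 < c → c ≤ x → c ≤ y → |log x − log y| ≤ |x − y| / c`).

/-! ## §4 The admissibility band and its eventual inhabitation -/

/-- **the band**: log-couplings `ℓ ≤ L_B`, `|L_A − L_B| ≤ ε ≤ ℓ`; then
`(1 − ε∕ℓ)^n · L_B^n ≤ L_A^n ≤ (1 + ε∕ℓ)^n · L_B^n` (thresholds `A₀ L^{p₀}` of the two runs, `n = p₀`). -/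
theorem pow_band {LA LB ℓ ε : ℝ} (hℓ : 0 < ℓ) (hB : ℓ ≤ LB) (hε : |LA - LB| ≤ ε) (hεℓ : ε ≤ ℓ) (n : ℕ) :
    (1 - ε / ℓ) ^ n * LB ^ n ≤ LA ^ n ∧ LA ^ n ≤ (1 + ε / ℓ) ^ n * LB ^ n := by
  have hLB : 0 < LB := hℓ.trans_le hB
  have hε0 : 0 ≤ ε := (abs_nonneg _).trans hε
  have h2 : ε ≤ ε / ℓ * LB := by
    rw [div_mul_eq_mul_div, le_div_iff₀ hℓ]; exact mul_le_mul_of_nonneg_left hB hε0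
  have hlo : (1 - ε / ℓ) * LB ≤ LA := by
    have h1 : LB - ε ≤ LA := by linarith [neg_abs_le (LA - LB)]
    calc (1 - ε / ℓ) * LB = LB - ε / ℓ * LB := by ring
      _ ≤ LB - ε := by linarith
      _ ≤ LA := h1
  have hhi : LA ≤ (1 + ε / ℓ) * LB := by
    have h1 : LA ≤ LB + ε := by linarith [le_abs_self (LA - LB)]
    calc LA ≤ LB + ε := h1
      _ ≤ LB + ε / ℓ * LB := by linarith
      _ = (1 + ε / ℓ) * LB := by ring
  have h0 : 0 ≤ (1 - ε / ℓ) * LB := mul_nonneg (sub_nonneg.2 ((div_le_one hℓ).2 hεℓ)) hLB.le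
  refine ⟨?_, ?_⟩
  · rw [← mul_pow]; exact pow_le_pow_left₀ h0 hlo n
  · rw [← mul_pow]; exact pow_le_pow_left₀ (h0.trans hlo) hhi n

/-- **the band is inhabited from a `K`-INDEPENDENT age on**: a geometric discrepancy `C θ^j` is below any `η > 0`
for `j ≥ j₀(C, θ, η)`. -/
theorem eventually_le_of_geometric {C θ η : ℝ} (hC : 0 ≤ C) (hθ0 : 0 ≤ θ) (hθ1 : θ < 1) (hη : 0 < η) :
    ∃ j₀ : ℕ, ∀ j ≥ j₀, C * θ ^ j ≤ η := by
  rcases eq_or_lt_of_le hC with h | hC'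
  · exact ⟨0, fun j _ => by rw [← h, zero_mul]; exact hη.le⟩
  obtain ⟨j₀, hj₀⟩ := exists_pow_lt_of_lt_one (div_pos hη hC') hθ1
  refine ⟨j₀, fun j hj => ?_⟩
  have hmono : θ ^ j ≤ θ ^ j₀ := pow_le_pow_of_le_one hθ0 hθ1.le hj
  have h2 : θ ^ j₀ * C < η := by rwa [lt_div_iff₀ hC'] at hj₀
  calc C * θ ^ j ≤ C * θ ^ j₀ := mul_le_mul_of_nonneg_left hmono hC
    _ = θ ^ j₀ * C := mul_comm _ _
    _ ≤ η := h2.le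

/-- **U2 closeness ⇒ run A's table is admissible for run B from age `j₀` on** (composition of §3–§4): with
`x ≥ m`, `log x ≥ ℓ > 0`, `|x_A − x_B| ≤ C θ^j`, for every `ε ∈ (0, ℓ]` there is a `K`-independent `j₀` beyond which
the log-couplings are `ε`-close, whence `pow_band` applies. -/
theorem logClose_from_age {C θ m ℓ ε : ℝ} (hC : 0 ≤ C) (hθ0 : 0 ≤ θ) (hθ1 : θ < 1) (hm : 0 < m) (hε : 0 < ε)
    (xA xB : ℕ → ℝ) (hxA : ∀ j, m ≤ xA j) (hxB : ∀ j, m ≤ xB j) (hU2 : ∀ j, |xA j - xB j| ≤ C * θ ^ j)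
    (_hℓ : ∀ j, ℓ ≤ Real.log (xB j)) :
    ∃ j₀ : ℕ, ∀ j ≥ j₀, |Real.log (xA j) - Real.log (xB j)| ≤ ε := by
  obtain ⟨j₀, hj₀⟩ := eventually_le_of_geometric hC hθ0 hθ1 (mul_pos hε hm)
  refine ⟨j₀, fun j hj => ?_⟩
  calc |Real.log (xA j) - Real.log (xB j)| ≤ |xA j - xB j| / m := Literature.Probability.RandomMatrixProducts.abs_log_sub_log_le hm (hxA j) (hxB j)
    _ ≤ C * θ ^ j / m := div_le_div_of_nonneg_right (hU2 j) hm.le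
    _ ≤ ε * m / m := div_le_div_of_nonneg_right (hj₀ j hj) hm.le
    _ = ε := mul_div_cancel_right₀ ε hm.ne'

/-! ## §5 Early ages: a species with finitely many birth ages is summable over the steps -/

/-- **early-age shells are summable**: per birth age `j < j₀` a survival density `≤ C r^{K−j}` at step `K`
(`0 < r < 1`: survival beats entropy — NE7b's margin `4 log L < p″∕N′`), total over `K` finite. -/
theorem summable_earlyShell (C r : ℝ) (hr0 : 0 ≤ r) (hr1 : r < 1) (j₀ : ℕ) :
    Summable fun K : ℕ => ∑ j ∈ Finset.range j₀, C * r ^ (K - j) := by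
  refine summable_sum fun j _ => ?_
  have h : Summable fun K : ℕ => C * r ^ (K + j - j) := by
    have e : (fun K : ℕ => C * r ^ (K + j - j)) = fun K => C * r ^ K := by
      funext K; rw [Nat.add_sub_cancel]
    rw [e]; exact (summable_geometric_of_lt_one hr0 hr1).mul_left C
  exact (summable_nat_add_iff (f := fun K : ℕ => C * r ^ (K - j)) j).1 h

/-- … and dominated species inherit it (the W-AM′ error of the shell species at step `K` is at most its O(1)
log-ratio budget times this density). -/
theorem summable_of_earlyShell_bound (δ : ℕ → ℝ) (C r : ℝ) (hr0 : 0 ≤ r) (hr1 : r < 1) (j₀ : ℕ)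
    (hδ0 : ∀ K, 0 ≤ δ K) (hδ : ∀ K, δ K ≤ ∑ j ∈ Finset.range j₀, C * r ^ (K - j)) : Summable δ :=
  Summable.of_nonneg_of_le hδ0 hδ (summable_earlyShell C r hr0 hr1 j₀)

end Summit.QuantumFields.BalabanUV.T4Continuum.WAM.ClassifierSync
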